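import Literature.AlgebraicTopology.Homotopy.StrongDeformationRetract
import HarnessLib

/-!
# A collar strong deformation retracts onto its base

Topic `Literature/AlgebraicTopology/Homotopy`; companion to `StrongDeformationRetract.lean`
(`IsStrongDeformationRetractOf A S`), `StrongDeformationRetractTransport.lean` (transport to
subspaces and along embeddings) and `StrongDeformationRetractUnion.lean` (absorbing a collar).

* `IsStrongDeformationRetractOf.cylinder_base` — for a topological embedding
  `c : B × [0, 1] → M` (a **collar**: Hirsch, *Differential Topology* (1976), §4.6; the shape of
  the tree's `Literature.Topology.FourManifolds.BoundaryData.Collar`), the base `c(B × {0})` is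
  a strong deformation retract of the open collar `c(B × [0, 1))` (and of the closed one,
  `IsStrongDeformationRetractOf.cylinder_base_closed`): slide along the collar lines,
  `H_s (c (x, t)) = c (x, (1 - s) t)`.

Together with `StrongDeformationRetractTransport.lean` (moving the collar of an abstract
manifold piece into the ambient space and into subspaces) and `StrongDeformationRetractUnion.lean`
(absorbing a collar of the neighbouring piece) this produces the open neighbourhoods, deformation
retracting onto closed manifold pieces, through which van Kampen's theorem is applied to Heegaard
splittings and trisections (`Literature/AlgebraicTopology/FundamentalGroup/VanKampenDeformation.lean`).

## References

* A. Hatcher, *Algebraic Topology*, CUP (2002), Ch. 0, p. 2 (deformation retractions).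
  [HatcherAT2002]
* M. W. Hirsch, *Differential Topology*, GTM 33 (1976), §4.6 (collars). [Hirsch1976]
-/

noncomputable section

open Set Function Topology
open scoped unitInterval Topology

namespace Literature.AlgebraicTopology.Homotopy

namespace IsStrongDeformationRetractOf

/-! ### A collar retracts onto its base -/

section Cylinder

variable {B M : Type*} [TopologicalSpace B] [TopologicalSpace M]

/-- Scaling the collar parameter: `(s, t) ↦ (1 - s) t` on `[0, 1] × [0, 1] → [0, 1]`.
[folklore] -/
theorem cylinder_scale_mem (s : I) (t : Icc (0 : ℝ) 1) : (1 - (s : ℝ)) * (t : ℝ) ∈ Icc (0 : ℝ) 1 :=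
  ⟨mul_nonneg (sub_nonneg.2 s.2.2) t.2.1,
    (mul_le_of_le_one_left t.2.1 (sub_le_self _ s.2.1)).trans t.2.2⟩

/-- **A collar strong deformation retracts onto its base (closed collar).**  For a topological
embedding `c : B × [0, 1] → M`, the base `c (B × {0})` is a strong deformation retract of the
image `c (B × [0, 1])`, by sliding along the collar lines `H_s (c (x, t)) = c (x, (1 - s) t)`
(Hirsch (1976), §4.6; used in every application of van Kampen's theorem to manifolds glued along
boundaries). [folklore] -/
theorem cylinder_base_closed (c : B × Icc (0 : ℝ) 1 → M) (hc : IsEmbedding c) :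
    IsStrongDeformationRetractOf (c '' {p | (p.2 : ℝ) = 0}) (range c) := by
  let φ := hc.toHomeomorph
  -- the deformation on `range c`, in collar coordinates
  let G : I × ↥(range c) → ↥(range c) := fun q =>
    ⟨c ((φ.symm q.2).1, ⟨(1 - (q.1 : ℝ)) * ((φ.symm q.2).2 : ℝ), cylinder_scale_mem q.1 _⟩),
      mem_range_self _⟩
  have hG : Continuous G := by
    refine (hc.continuous.comp ?_).subtype_mk _
    refine (continuous_fst.comp (φ.symm.continuous.comp continuous_snd)).prodMk ?_
    refine Continuous.subtype_mk ?_ _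
    exact ((continuous_const.sub (continuous_subtype_val.comp continuous_fst)).mul
      (continuous_subtype_val.comp (continuous_snd.comp (φ.symm.continuous.comp continuous_snd))))
  have hφ : ∀ p : B × Icc (0 : ℝ) 1, φ.symm ⟨c p, mem_range_self p⟩ = p := fun p =>
    hc.toHomeomorph_symm_apply p
  have hcφ : ∀ q : ↥(range c), c (φ.symm q) = q := by
    rintro ⟨_, p, rfl⟩
    rw [hφ]
  refine ⟨⟨G, hG⟩, fun q => ?_, fun q => ?_, fun s q hq => ?_⟩
  · -- `s = 0`: `(1 - 0) t = t`
    apply Subtype.ext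
    show c ((φ.symm q).1, ⟨(1 - ((0 : I) : ℝ)) * ((φ.symm q).2 : ℝ), _⟩) = q
    have : (⟨(1 - ((0 : I) : ℝ)) * ((φ.symm q).2 : ℝ), cylinder_scale_mem 0 _⟩ : Icc (0 : ℝ) 1) =
        (φ.symm q).2 := Subtype.ext (by simp)
    rw [this, Prod.mk.eta, hcφ]
  · -- `s = 1`: lands on the base
    show c ((φ.symm q).1, ⟨(1 - ((1 : I) : ℝ)) * ((φ.symm q).2 : ℝ), _⟩) ∈ c '' {p | (p.2 : ℝ) = 0}
    exact mem_image_of_mem c (by simp)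
  · -- base points are fixed
    apply Subtype.ext
    obtain ⟨p, hp, hpq⟩ := hq
    have hq' : q = ⟨c p, mem_range_self p⟩ := Subtype.ext hpq.symm
    subst hq'
    show c ((φ.symm ⟨c p, _⟩).1, ⟨(1 - (s : ℝ)) * ((φ.symm ⟨c p, _⟩).2 : ℝ), _⟩) = c p
    have hp0 : ((p.2 : ℝ)) = 0 := hp
    congr 1
    rw [hφ p]
    ext
    · rfl
    · show (1 - (s : ℝ)) * (p.2 : ℝ) = p.2
      rw [hp0, mul_zero]

/-- **A collar strong deformation retracts onto its base (open collar).**  For a topological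
embedding `c : B × [0, 1] → M`, the base `c (B × {0})` is a strong deformation retract of the
open collar `c (B × [0, 1))` (the same sliding deformation preserves `t < 1`).  This is the open
neighbourhood of a boundary component / of a handlebody of a Heegaard splitting that deformation
retracts onto it (Hirsch (1976), §4.6). [folklore] -/
theorem cylinder_base (c : B × Icc (0 : ℝ) 1 → M) (hc : IsEmbedding c) :
    IsStrongDeformationRetractOf (c '' {p | (p.2 : ℝ) = 0}) (c '' {p | (p.2 : ℝ) < 1}) := by
  let φ := hc.toHomeomorph
  have hφ : ∀ p : B × Icc (0 : ℝ) 1, φ.symm ⟨c p, mem_range_self p⟩ = p := fun p =>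
    hc.toHomeomorph_symm_apply p
  have hsub : c '' {p | (p.2 : ℝ) < 1} ⊆ range c := image_subset_range _ _
  -- the same sliding deformation as in the closed case, which preserves `t < 1`
  let G : I × ↥(c '' {p | (p.2 : ℝ) < 1}) → ↥(c '' {p | (p.2 : ℝ) < 1}) := fun q =>
    ⟨c ((φ.symm ⟨q.2, hsub q.2.2⟩).1,
        ⟨(1 - (q.1 : ℝ)) * ((φ.symm ⟨q.2, hsub q.2.2⟩).2 : ℝ), cylinder_scale_mem q.1 _⟩), by
      refine mem_image_of_mem c ?_
      obtain ⟨p, hp, hpq⟩ := q.2.2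
      have hq : (⟨(q.2 : M), hsub q.2.2⟩ : range c) = ⟨c p, mem_range_self p⟩ :=
        Subtype.ext hpq.symm
      show (1 - (q.1 : ℝ)) * ((φ.symm ⟨q.2, hsub q.2.2⟩).2 : ℝ) < 1
      rw [hq, hφ p]
      have hp1 : (p.2 : ℝ) < 1 := hp
      exact (mul_le_of_le_one_left p.2.2.1 (sub_le_self _ q.1.2.1)).trans_lt hp1⟩
  have hG : Continuous G := by
    refine (hc.continuous.comp ?_).subtype_mk _
    have hι : Continuous fun y : ↥(c '' {p | (p.2 : ℝ) < 1}) => (⟨(y : M), hsub y.2⟩ : range c) :=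
      continuous_subtype_val.subtype_mk _
    refine (continuous_fst.comp (φ.symm.continuous.comp (hι.comp continuous_snd))).prodMk ?_
    refine Continuous.subtype_mk ?_ _
    exact ((continuous_const.sub (continuous_subtype_val.comp continuous_fst)).mul
      (continuous_subtype_val.comp (continuous_snd.comp
        (φ.symm.continuous.comp (hι.comp continuous_snd)))))
  refine ⟨⟨G, hG⟩, fun q => ?_, fun q => ?_, fun s q hq => ?_⟩
  · obtain ⟨qv, p, hp, rfl⟩ := q
    apply Subtype.ext
    show c ((φ.symm ⟨c p, _⟩).1, ⟨(1 - ((0 : I) : ℝ)) * ((φ.symm ⟨c p, _⟩).2 : ℝ), _⟩) = c p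
    congr 1
    rw [hφ p]
    ext
    · rfl
    · show (1 - ((0 : I) : ℝ)) * (p.2 : ℝ) = p.2
      simp
  · show c ((φ.symm ⟨q, hsub q.2⟩).1, ⟨(1 - ((1 : I) : ℝ)) * ((φ.symm ⟨q, hsub q.2⟩).2 : ℝ), _⟩)
      ∈ c '' {p | (p.2 : ℝ) = 0}
    exact mem_image_of_mem c (by simp)
  · obtain ⟨p, hp, hpq⟩ := hq
    obtain ⟨qv, hqv⟩ := q
    change c p = qv at hpq
    subst hpq
    apply Subtype.ext
    show c ((φ.symm ⟨c p, _⟩).1, ⟨(1 - (s : ℝ)) * ((φ.symm ⟨c p, _⟩).2 : ℝ), _⟩) = c p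
    congr 1
    rw [hφ p]
    have hp0 : (p.2 : ℝ) = 0 := hp
    ext
    · rfl
    · show (1 - (s : ℝ)) * (p.2 : ℝ) = p.2
      rw [hp0, mul_zero]

end Cylinder

end IsStrongDeformationRetractOf

end Literature.AlgebraicTopology.Homotopy

end
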